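import Literature.Probability.LatticeModels.IsingBubbleDivergence
import Literature.Probability.LatticeModels.CriticalTwoPointDCPLower
import Literature.Probability.LatticeModels.TwoPointGradientEstimate
import Literature.Barriers.CriticalPhenomena.LaceExpansionIsingAboveFourNarrowProofs
import Literature.Probability.LatticeModels.SharpLengthDCPTorus
import HarnessLib

/-!
# Divergence of the bubble diagram on `ℤ³` and `ℤ⁴` (Duminil-Copin–Panis 2025, Theorem 1.8):
# reduction to the reflected-current inequality (Theorem 1.2)

Topic `Literature/Probability/LatticeModels`; theorem-only proof companion of
`IsingBubbleDivergence.lean` (no definition, no named fact).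

H. Duminil-Copin, R. Panis, *New lower bounds for the (near) critical Ising and φ⁴ models'
two-point functions*, Comm. Math. Phys. 406 (2025) = arXiv:2404.05700, prove Theorem 1.8
("Let `d = 3, 4`. Then `B(β_c) = ∞`") on p. 7 from three inputs: (i) Theorem 1.2, the
reflected-random-current inequality
`β ∑_{x,y ∈ Λ_n, y ∼ x} (⟨τ₀τ_x⟩_β - ⟨τ₀τ_{𝓡_n(x)}⟩_β) ⟨τ_yτ_{𝓡_n(y)}⟩_β ≥ c₀` (`N₀ ≤ n ≤ L(β)`;
at `β = β_c`, `L(β_c) = ∞`); (ii) the gradient estimate (1.11) from the spectral representation;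
(iii) the Messager–Miracle-Solé inequalities, Cauchy–Schwarz and the divergence of `∑ 1/n`,
`∑ 1/(n log n)`.  In the tree, (ii) is the theorem `twoPointFree_criticalBeta_gradient_estimate`
(`TwoPointGradientEstimate.lean`, from reflection positivity), (iii) and the whole analytic
endgame of the printed proof is the theorem
`Literature.Barriers.CriticalPhenomena.NNIsing.not_bubbleCondition_of_dcp`
(`LaceExpansionIsingAboveFourNarrowProofs.lean`), and (i) at `β = β_c` is the NAMED FACT
`dcp_reflectedGradient_lower` (`CriticalTwoPointDCPLower.lean`, Theorem 1.2 as printed, first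
axis, the factor `β_c` absorbed in `c₀`).

This file assembles them: **Theorem 1.8 follows from Theorem 1.2 at `β_c` in `d = 3` and
`d = 4`** (`DuminilCopinPanis2025_bubbleDiagram_eq_top_of_reflectedGradient_lower`), so that the
discharge `DuminilCopinPanis2025_bubbleDiagram_eq_top_holds` is exactly the discharge of
`dcp_reflectedGradient_lower` in dimensions `3` and `4`.  The only work done here is the
dictionary between the printed sum of Theorem 1.2 (reflection `𝓡_n = dcpReflect 0 n`, pair
correlation `⟨τ_yτ_{𝓡_n(y)}⟩_{β_c} = freeExpect d β_c 0 (spinPair y (𝓡_n y))`, indicator of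
`y ∼ x`) and hypothesis (H1) of `not_bubbleCondition_of_dcp` (reflection `axisRefl 0 (2n)`,
`G(y - 𝓡_n y)`, filtered sum), which is translation invariance and evenness of the free
two-point function (Friedli–Velenik 2017, Exercise 3.16 / Thm. 3.17 (2); tree:
`freeCorr_shift`, `twoPointFree_abs_eq`).

## References

* H. Duminil-Copin, R. Panis, Comm. Math. Phys. 406 (2025), arXiv:2404.05700, Theorems 1.2, 1.8
  and the proof of Theorem 1.8 (p. 7 of the arXiv version, held: `paper:arxiv-2404.05700`)
  [DuminilCopinPanis2025LowerBounds].
* S. Friedli, Y. Velenik, *Statistical Mechanics of Lattice Systems* (CUP 2017), Exercise 3.16,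
  Thm. 3.17 (2) [FriedliVelenik2017].
-/

noncomputable section

open Filter Finset
open scoped ENNReal Topology

namespace Literature.Probability.LatticeModels

variable {d : ℕ}

/-- **Translation invariance of the free pair correlation**: `⟨σ_xσ_y⟩^∅_{β,0} = ⟨σ₀σ_{y-x}⟩^∅_{β,0}`
for `β ≥ 0` (Friedli–Velenik 2017, Exercise 3.16 with Thm. 3.17 (2); the tree's `freeCorr_shift`
at `A = {0, y - x}`, `v = x`; for `x = y` both sides are `1`).
[cite: FriedliVelenik2017, Exercise 3.16 with Thm. 3.17 (2)] -/
theorem freeExpect_spinPair_eq_twoPointFree_sub {β : ℝ} (hβ : 0 ≤ β) (x y : Site d) :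
    freeExpect d β 0 (spinPair x y) = twoPointFree d β (y - x) := by
  classical
  rcases eq_or_ne x y with rfl | hxy
  · rw [sub_self, twoPointFree_zero']
    have h2 : (fun L : ℕ => isingExpect (zdGraph d) (box d L) β 0 .free (spinPair x x)) =
        fun _ => (1 : ℝ) := by
      funext L
      exact isingTwoPoint_self (zdGraph d) (box d L) β 0 .free x
    rw [freeExpect, h2]
    exact (tendsto_const_nhds : Tendsto (fun _ : ℕ => (1 : ℝ)) atTop (𝓝 1)).limUnder_eq
  have h0 : (0 : Site d) ≠ y - x := fun h => hxy (sub_eq_zero.1 h.symm).symm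
  have hmap : (({0, y - x} : Finset (Site d)).map (Site.shift x).toEmbedding) = {x, y} := by
    rw [Finset.map_insert, Finset.map_singleton]
    simp
  have h1 : freeExpect d β 0 (spinPair x y) = freeCorr d β 0 {x, y} := by
    simp only [freeCorr, spinPair_eq_spinProduct hxy]
  have h2 : twoPointFree d β (y - x) = freeCorr d β 0 {0, y - x} := by
    simp only [twoPointFree, freeCorr, spinPair_eq_spinProduct h0]
  rw [h1, h2, ← freeCorr_shift d hβ le_rfl x {0, y - x}, hmap]

/-- Evenness of the free two-point function, `⟨σ₀σ_{-x}⟩^∅_β = ⟨σ₀σ_x⟩^∅_β` (`β ≥ 0`; reflect every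
coordinate, Friedli–Velenik 2017, Exercise 3.14). [cite: FriedliVelenik2017, Exercise 3.14] -/
theorem twoPointFree_neg_eq {β : ℝ} (hβ : 0 ≤ β) (x : Site d) :
    twoPointFree d β (-x) = twoPointFree d β x := by
  rw [← twoPointFree_abs_eq hβ (-x), ← twoPointFree_abs_eq hβ x]
  simp [abs_neg]

/-- The reflection `𝓡_n` of Duminil-Copin–Panis (`x₁ ↦ 2n - x₁`, `dcpReflect 0 n`) is the tree's
axis reflection `axisRefl 0 (2n)` through the hyperplane `{x₁ = n}`. [folklore] -/
theorem dcpReflect_eq_axisRefl (i : Fin d) (n : ℤ) (x : Site d) :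
    dcpReflect i n x = axisRefl i (2 * n) x := by
  funext j
  rw [dcpReflect, axisRefl_apply]
  by_cases hj : j = i
  · subst hj
    simp
  · simp [hj]

/-- **The printed sum of Theorem 1.2 is hypothesis (H1) of `not_bubbleCondition_of_dcp`.** For
`β = β_c ≥ 0`, every `n` and the first axis `e₁`:
`∑_{x,y ∈ Λ_n} 𝟙[y ∼ x] (G(x) - G(𝓡_n x)) ⟨σ_yσ_{𝓡_n y}⟩^∅_{β_c}
  = ∑_{x ∈ Λ_n} ∑_{y ∈ Λ_n, y ∼ x} (G(x) - G(R x)) G(y - R y)`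
with `G = ⟨σ₀σ_·⟩^∅_{β_c}`, `R = axisRefl e₁ (2n) = 𝓡_n` (translation invariance and evenness of `G`).
[cite: DuminilCopinPanis2025LowerBounds, Theorem 1.2 (the left-hand side)] -/
theorem dcp_reflectedSum_eq (hd : 1 ≤ d) (n : ℕ) :
    (∑ x ∈ box d n, ∑ y ∈ box d n,
      if (zdGraph d).Adj x y then
        (twoPointFree d (criticalBeta d) x -
            twoPointFree d (criticalBeta d) (dcpReflect (⟨0, hd⟩ : Fin d) (n : ℤ) x)) *
          freeExpect d (criticalBeta d) 0
            (spinPair y (dcpReflect (⟨0, hd⟩ : Fin d) (n : ℤ) y))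
      else 0) =
    ∑ x ∈ box d n, ∑ y ∈ (box d n).filter (fun y => (zdGraph d).Adj x y),
      (twoPointFree d (criticalBeta d) x -
          twoPointFree d (criticalBeta d) (axisRefl (⟨0, hd⟩ : Fin d) (2 * n) x)) *
        twoPointFree d (criticalBeta d) (y - axisRefl (⟨0, hd⟩ : Fin d) (2 * n) y) := by
  have hβ : 0 ≤ criticalBeta d := criticalBeta_nonneg d
  refine sum_congr rfl fun x _ => ?_
  rw [Finset.sum_filter]
  refine sum_congr rfl fun y _ => ?_
  split_ifs with hxy
  · rw [freeExpect_spinPair_eq_twoPointFree_sub hβ, dcpReflect_eq_axisRefl, dcpReflect_eq_axisRefl,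
      ← twoPointFree_neg_eq hβ (axisRefl (⟨0, hd⟩ : Fin d) (2 * (n : ℤ)) y - y), neg_sub]
  · rfl

/-- **Hypothesis (H1) of `not_bubbleCondition_of_dcp` from Theorem 1.2 at `β_c`** (the named fact
`dcp_reflectedGradient_lower`, `d ≥ 3`): there are `c₀ > 0` and `N₀` with
`c₀ ≤ ∑_{x ∈ Λ_n} ∑_{y ∈ Λ_n, y ∼ x} (G(x) - G(R_n x)) G(y - R_n y)` for all `n ≥ N₀`, along the
first axis. [cite: DuminilCopinPanis2025LowerBounds, Theorem 1.2] -/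
theorem dcp_reflectedGradient_lower.hrefl (hd : 3 ≤ d) (h : dcp_reflectedGradient_lower (d := d)) :
    ∃ c₀ : ℝ, 0 < c₀ ∧ ∃ N₀ : ℕ, ∀ n : ℕ, N₀ ≤ n →
      c₀ ≤ ∑ x ∈ box d n, ∑ y ∈ (box d n).filter (fun y => (zdGraph d).Adj x y),
        (twoPointFree d (criticalBeta d) x -
            twoPointFree d (criticalBeta d) (axisRefl (⟨0, by omega⟩ : Fin d) (2 * n) x)) *
          twoPointFree d (criticalBeta d) (y - axisRefl (⟨0, by omega⟩ : Fin d) (2 * n) y) := by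
  obtain ⟨c₀, hc₀, N₀, _hN₀, hN⟩ := h hd
  refine ⟨c₀, hc₀, N₀, fun n hn => ?_⟩
  rw [← dcp_reflectedSum_eq (by omega) n]
  exact hN n hn

open Literature.Barriers.CriticalPhenomena in
/-- **The bubble condition fails on `ℤ^d`, `d ∈ {3, 4}`, granted Theorem 1.2 at `β_c`**
(Duminil-Copin–Panis 2025, proof of Theorem 1.8, p. 7): (H1) is `dcp_reflectedGradient_lower`,
(H2) is the tree's theorem `twoPointFree_criticalBeta_gradient_estimate`, and the analytic
endgame is the tree's theorem `NNIsing.not_bubbleCondition_of_dcp`.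
[cite: DuminilCopinPanis2025LowerBounds, Theorem 1.8 (proof, p. 7) with Theorem 1.2] -/
theorem not_bubbleCondition_of_reflectedGradient_lower (hd : d = 3 ∨ d = 4)
    (h : dcp_reflectedGradient_lower (d := d)) : ¬ NNIsing.BubbleCondition d := by
  have hd3 : 3 ≤ d := by omega
  exact NNIsing.not_bubbleCondition_of_dcp hd (⟨0, by omega⟩ : Fin d)
    (fun x j hj => twoPointFree_criticalBeta_gradient_estimate hd3 _ x j hj)
    (dcp_reflectedGradient_lower.hrefl hd3 h)

open Literature.Barriers.CriticalPhenomena in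
/-- **Duminil-Copin–Panis 2025, Theorem 1.8, from Theorem 1.2 at `β_c` in `d = 3` and `d = 4`.**
`B(β_c) = Σ_x ⟨σ₀σ_x⟩²_{β_c} = ∞` on `ℤ³` and on `ℤ⁴` (the named fact
`DuminilCopinPanis2025_bubbleDiagram_eq_top`) follows from the reflected-current inequality
`dcp_reflectedGradient_lower` in these two dimensions — the printed proof (p. 7), all of whose
other ingredients (gradient estimate, Messager–Miracle-Solé, Cauchy–Schwarz, divergence of the
shell sums) are theorems of the tree. [cite: DuminilCopinPanis2025LowerBounds, Theorem 1.8 with Theorem 1.2] -/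
theorem DuminilCopinPanis2025_bubbleDiagram_eq_top_of_reflectedGradient_lower
    (h3 : dcp_reflectedGradient_lower (d := 3)) (h4 : dcp_reflectedGradient_lower (d := 4)) :
    DuminilCopinPanis2025_bubbleDiagram_eq_top :=
  ⟨not_lt_top_iff.1 (not_bubbleCondition_of_reflectedGradient_lower (Or.inl rfl) h3),
    not_lt_top_iff.1 (not_bubbleCondition_of_reflectedGradient_lower (Or.inr rfl) h4)⟩

/-- **Duminil-Copin–Panis 2025, Theorem 1.8 (discharge of the named fact
`DuminilCopinPanis2025_bubbleDiagram_eq_top`).** Printed (arXiv v1, p. 6): "Theorem 1.8 (Divergence of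
the bubble diagram). Let `d = 3, 4`. Then, `B(β_c) = ∞`." — `B(β) := Σ_{x ∈ ℤ^d} ⟨τ₀τ_x⟩²_β` the bubble
diagram of the nearest-neighbour Ising model. Proof as printed (pp. 6–7, by contradiction from
`B(β_c) < ∞`): Theorem 1.2 at `β_c` in `d = 3` and `d = 4` — the tree's theorem
`DCPNearCritical.dcp_critical_holds` (`SharpLengthDCPTorus.lean`: §2.2 of the source, Lemmas 2.3–2.5 on the
even tori and `Λ ↗ ℤ^d`; its `_holds`-named form is `dcp_reflectedGradient_lower_holds`,
`CriticalTwoPointDCPLowerHolds.lean`) — fed into the reduction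
`DuminilCopinPanis2025_bubbleDiagram_eq_top_of_reflectedGradient_lower` above (gradient estimate (1.11),
Messager–Miracle-Solé, Cauchy–Schwarz, divergence of the shell sums).
[cite: DuminilCopinPanis2025LowerBounds, Theorem 1.8] -/
theorem DuminilCopinPanis2025_bubbleDiagram_eq_top_holds : DuminilCopinPanis2025_bubbleDiagram_eq_top :=
  DuminilCopinPanis2025_bubbleDiagram_eq_top_of_reflectedGradient_lower
    (DCPNearCritical.dcp_critical_holds (d := 3)).1 (DCPNearCritical.dcp_critical_holds (d := 4)).1

end Literature.Probability.LatticeModels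

end
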